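import Literature.AnabelianGeometry.AbsoluteAnabelian.AbsAnabProp121viiSub
import HarnessLib

/-!
# [AbsAnab] Prop 1.2.1 (vii), sub-DAG row L01a: the cup product commutes with the transport along `α`

Proof-only companion (abc-iut cell, D-0068 (1) full-M discharge; layer L4; node `AbsAnab:Prop1.2.1(vii)`,
sub-DAG `plan/L4/SUBDAG-AbsAnab-Prop121vii.md` row **L01a `CohTransportCup`**; statements file
`AbsAnabProp121viiSub.lean` by abc-iut-w5-d198, consumed BY NAME and not restated). S. Mochizuki, *The
Absolute Anabelian Geometry of Hyperbolic Curves* (2004) [AbsAnab], §1.2, Prop 1.2.1 (vii) p. 11 ("the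
morphism … induced by `α`"): the homological algebra behind "induced by `α`" — the cup product
`H¹(G_K, μ_n) × H¹(G_K, Hom(μ_n, μ_n)) → H²(G_K, μ_n)` of the tree (`ContPairing.cupProduct` for
`tateDualPairing (mu K n) n`) is natural under the transport
`T = galoisCohomology.map (ψ̄|μ_n) ∘ galoisCohomology.pullback (α⁻¹)` (`Prop121vii.cohTransport`).

PROVED here (`cohTransportCup_holds`), classically and fact-free: write `x = [f]`
(`oneCocycleClass_surjective`); both transports are computed on explicit cocycles by Mathlib's
functoriality (`map_oneCocycleClass`, `map_twoCocycleClass`: `[f] ↦ [ψ̄ ∘ f ∘ α⁻¹]`,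
`[c] ↦ [ψ̄ ∘ c ∘ (α⁻¹ × α⁻¹)]`), the cup products by the inhomogeneous formula
`(f ∪ g)(σ, τ) = ⟨f σ, g(στ) − g σ⟩` (`ContPairing.cupCocycle_apply`), and the two resulting `2`-cocycles
`G_{K₂} × G_{K₂} → μ_n(K̄₂)` coincide pointwise:
`ψ̄((g₁(α⁻¹σ·α⁻¹τ) − g₁(α⁻¹σ))(f(α⁻¹σ))) = (g₂(στ) − g₂ σ)(ψ̄ f(α⁻¹σ))` by the correspondence
`g₂(α σ′)(ψ̄ m) = ψ̄(g₁(σ′) m)` of the hypothesis.  Reference for the statement: Neukirch–Schmidt–Wingberg,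
*Cohomology of Number Fields* (2008), I §4 (1.4.2) (functoriality of the cup product).
HONEST FRAMING: classical, undisputed; nothing here bears on [IUTchIII] Cor. 3.12.
-/

noncomputable section


namespace Literature.AnabelianGeometry.AbsoluteAnabelian

open Field CategoryTheory ValuativeRel ContRepresentation
open Literature.NumberTheory.GaloisRepresentations
open Literature.NumberTheory.GaloisRepresentations.DiscreteGaloisModule

namespace Prop121vii

universe uu

variable {K₁ K₂ : Type uu} [Field K₁] [Field K₂]

/-- **L01a `CohTransportCup` holds**: naturality of the cup product `H¹ × H¹ → H²` under the transport
along `(α, ψ̄|μ_n)` — computed on inhomogeneous cocycles: both sides are the class of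
`(σ, τ) ↦ ψ̄(g₁(α⁻¹σ·α⁻¹τ)(f(α⁻¹σ))) − ψ̄(g₁(α⁻¹σ)(f(α⁻¹σ)))`. [cite: NeukirchSchmidtWingberg2008, I §4 (1.4.2)] -/
theorem cohTransportCup_holds (α : absoluteGaloisGroup K₁ ≃ₜ* absoluteGaloisGroup K₂)
    (ψ : (AlgebraicClosure K₁)ˣ ≃* (AlgebraicClosure K₂)ˣ) (n : ℕ) [Finite (MuCarrier K₁ n)]
    [Finite (MuCarrier K₂ n)] : CohTransportCup α ψ n := by
  intro hμ g₁ g₂ hg x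
  haveI : CompactSpace (absoluteGaloisGroup K₁) := absoluteGaloisGroup_compactSpace K₁
  haveI : CompactSpace (absoluteGaloisGroup K₂) := absoluteGaloisGroup_compactSpace K₂
  obtain ⟨f, rfl⟩ := oneCocycleClass_surjective _ x
  -- the two morphisms through which the transport factors (pull back along `θ = α⁻¹`, then change
  -- coefficients along `ψ̄|μ_n`)
  let θ : absoluteGaloisGroup K₂ →ₜ* absoluteGaloisGroup K₁ := α.symm
  let IdX : TopRep.res (θ : absoluteGaloisGroup K₂ →* absoluteGaloisGroup K₁) (mu K₁ n).toTopRep ⟶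
      DiscreteGaloisModule.toTopRep (ContinuousRep.restrict (mu K₁ n) θ) :=
    TopRep.ofHom ⟨ContinuousLinearMap.id ℤ (MuCarrier K₁ n), fun _ => rfl⟩
  let Fμ : TopRep.res ((ContinuousMonoidHom.id (absoluteGaloisGroup K₂) :
        absoluteGaloisGroup K₂ →ₜ* absoluteGaloisGroup K₂) : absoluteGaloisGroup K₂ →* absoluteGaloisGroup K₂)
        (DiscreteGaloisModule.toTopRep (ContinuousRep.restrict (mu K₁ n) θ)) ⟶ (mu K₂ n).toTopRep :=
    TopRep.ofHom ⟨(intertwiningOfEquivariant α (mu K₁ n) (mu K₂ n) (muCarrierMap ψ.toMonoidHom n)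
        hμ).toContinuousLinearMap,
      (intertwiningOfEquivariant α (mu K₁ n) (mu K₂ n) (muCarrierMap ψ.toMonoidHom n) hμ).isIntertwining'⟩
  -- the transport on explicit cocycles, degrees 1 and 2
  have hT1 : cohTransport α (mu K₁ n) (mu K₂ n) (muCarrierMap ψ.toMonoidHom n) hμ 1
        (oneCocycleClass _ f) =
      oneCocycleClass _ (contOneCocycles.pullback (ContinuousMonoidHom.id _) Fμ
        (contOneCocycles.pullback θ IdX f)) := by
    show (ContinuousCohomology.map (ContinuousMonoidHom.id _) Fμ 1)
        ((ContinuousCohomology.map θ IdX 1) (oneCocycleClass _ f)) = _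
    rw [map_oneCocycleClass, map_oneCocycleClass]
  have hT2 : ∀ c : contTwoCocycles (mu K₁ n).toTopRep,
      cohTransport α (mu K₁ n) (mu K₂ n) (muCarrierMap ψ.toMonoidHom n) hμ 2 (twoCocycleClass _ c) =
        twoCocycleClass _ (contTwoCocycles.pullback (ContinuousMonoidHom.id _) Fμ
          (contTwoCocycles.pullback θ IdX c)) := fun c => by
    show (ContinuousCohomology.map (ContinuousMonoidHom.id _) Fμ 2)
        ((ContinuousCohomology.map θ IdX 2) (twoCocycleClass _ c)) = _
    rw [map_twoCocycleClass, map_twoCocycleClass]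
  rw [ContPairing.cupProduct_oneCocycleClass_eq_twoCocycleClass, hT2, hT1,
    ContPairing.cupProduct_oneCocycleClass_eq_twoCocycleClass]
  refine congrArg (twoCocycleClass _) (Subtype.ext (ContinuousMap.ext fun p => ?_))
  obtain ⟨σ, τ⟩ := p
  -- evaluate the two pairings and the two morphisms
  have hαθ : ∀ y : absoluteGaloisGroup K₂, α (θ y) = y := fun y => α.apply_symm_apply y
  have hsub₁ : ∀ (h h' : TateDual K₁ (MuCarrier K₁ n) n) (m : MuCarrier K₁ n),
      (h - h') m = h m - h' m := fun _ _ _ => rfl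
  have hsub₂ : ∀ (h h' : TateDual K₂ (MuCarrier K₂ n) n) (m : MuCarrier K₂ n),
      (h - h') m = h m - h' m := fun _ _ _ => rfl
  have e1 : ∀ m : MuCarrier K₁ n,
      g₂.1 σ (muCarrierMap ψ.toMonoidHom n m) = muCarrierMap ψ.toMonoidHom n (g₁.1 (θ σ) m) := by
    intro m
    have := hg (θ σ) m
    rw [hαθ] at this
    exact this
  have e2 : ∀ m : MuCarrier K₁ n,
      g₂.1 (σ * τ) (muCarrierMap ψ.toMonoidHom n m) =
        muCarrierMap ψ.toMonoidHom n (g₁.1 (θ σ * θ τ) m) := by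
    intro m
    have := hg (θ (σ * τ)) m
    rw [hαθ, map_mul θ σ τ] at this
    exact this
  change muCarrierMap ψ.toMonoidHom n ((g₁.1 (θ σ * θ τ) - g₁.1 (θ σ)) (f.1 (θ σ))) =
    (g₂.1 (σ * τ) - g₂.1 σ) (muCarrierMap ψ.toMonoidHom n (f.1 (θ σ)))
  rw [hsub₁, hsub₂, e1, e2]
  exact map_sub (muCarrierMap ψ.toMonoidHom n) _ _

end Prop121vii

end Literature.AnabelianGeometry.AbsoluteAnabelian

end
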